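import Summits.Ventures.AbcSig.Rows.TemplateHalves
import Summits.Ventures.AbcSig.Rows.XTemplateAB

/-!
# Venture AbcSig — EXTENDED-EXCLUSION twin of `Rows/TemplateHalves.lean` (GENERATED by gen/mkxtemplates.py)

HONEST FRAMING. Template file of a COMPUTATION cell (`pub-abcsig`); no claim on ABC or any summit. Each theorem
`x<name>` below is the theorem `<name>` of `Rows/TemplateHalves.lean` with ONE change: the per-orbit alternative of every level
hypothesis reads `o.Eliminated bs04Allowed n ∨ (M.Excludes N o fam ∨ M.ExcludesStd N o n)` instead of
`o.Eliminated bs04Allowed n ∨ M.Excludes N o fam`, where `M.ExcludesStd N o n` (`Recipes/EisPackage.lean`) says that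
no STANDING datum with exponent `n` has its mod-`n` representation arising from a newform matching `o` — the shape
in which the cell's module-M6 (Eisenstein congruence) certificates are discharged by the kernel
(`NewformModel.excludesStd_of_m6`, given the cited `EisPackage` and the computed `Refines`). Proofs are the originals
verbatim up to the renamed callee; the final step is `xno_solution_in_case`.
-/

namespace Summit.Ventures.AbcSig



/-- **Class `a ∈ {4, 5}`, `y` odd** (distribution `(1, 2^a ℓ^m)`; level `8ℓ`). -/
theorem xrowC2a_a45_yodd (ℓ : ℕ) (hℓ : ℓ.Prime) (hℓ2 : ℓ ≠ 2) (M : NewformModel) (hP : M.BS04Package)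
    (n : ℕ) (hn : n.Prime) (h7 : 7 ≤ n) (hnℓ : n ≠ ℓ) {orbs8 : List OrbitData} (hD8 : M.DataComplete (8 * ℓ) orbs8)
    (a m : ℕ) (ha : a = 4 ∨ a = 5) (hm : 1 ≤ m) (han : a < n) (hmn : m < n)
    (hS8 : ∀ o ∈ orbs8, (∀ e ∈ o.coeffs, e.ell.Prime ∧ e.ell ≠ 2 ∧ ¬ e.ell ∣ 8 * ℓ) ∧
      (o.Eliminated bs04Allowed n ∨ (M.Excludes (8 * ℓ) o (famB (2 ^ a * ℓ ^ m) n (fun _ _ => True)) ∨ M.ExcludesStd (8 * ℓ) o n)))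
    (x y z : ℤ) (hy : ¬ 2 ∣ y) (hxy1 : x * y ≠ 1) (hxy2 : x * y ≠ -1) :
    ¬ IsPrimitiveSolution 1 (2 ^ a * ℓ ^ m) 1 n x y z := by
  intro hsol
  have hB : 0 < 2 ^ a * ℓ ^ m := by have := hℓ.pos; positivity
  have hnB := not_dvd_twoPow_primePow ℓ a m n hℓ hn (by omega) hnℓ
  have hfreeB := nthPowerFree_twoPow_primePow ℓ a m n hℓ hℓ2 han hmn
  obtain ⟨-, -, hL8, -⟩ := levelsC2a ℓ hℓ hℓ2 n hnℓ a m hm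
  have hℓodd := prime_odd_int ℓ hℓ hℓ2
  have hBeven : 2 ∣ ((2 ^ a * ℓ ^ m : ℕ) : ℤ) := by
    have : (2 : ℕ) ∣ 2 ^ a * ℓ ^ m := Dvd.dvd.mul_right (dvd_pow_self 2 (by omega)) _
    exact_mod_cast this
  have hx := odd_x_of_even_B hsol hBeven
  have hxy : ¬ 2 ∣ x * y := not_two_dvd_mul hx hy
  have hB45 : OrdTwoEq ((2 ^ a * ℓ ^ m : ℕ) : ℤ) 4 ∨ OrdTwoEq ((2 ^ a * ℓ ^ m : ℕ) : ℤ) 5 := by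
    rcases ha with rfl | rfl
    · left; push_cast; exact ordTwoEq_twoPow_mul_odd 4 _ (not_two_dvd_pow hℓodd m)
    · right; push_cast; exact ordTwoEq_twoPow_mul_odd 5 _ (not_two_dvd_pow hℓodd m)
  exact xbranch_iv45 _ hB M hP n hn h7 hnB hfreeB (8 * ℓ) hL8 (fun _ _ => True) hD8 hS8 x y z trivial hB45 hxy hxy1
    hxy2 hsol

/-- Distribution `(ℓ^m, 2^a)`, **class `a ∈ {4, 5}`, `y` odd** (level `8ℓ`). -/
theorem xrowC2aAB_a45_yodd (ℓ : ℕ) (hℓ : ℓ.Prime) (hℓ2 : ℓ ≠ 2) (M : NewformModel) (hP : M.BS04Package)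
    (n : ℕ) (hn : n.Prime) (h7 : 7 ≤ n) (hnℓ : n ≠ ℓ) {orbs8 : List OrbitData} (hD8 : M.DataComplete (8 * ℓ) orbs8)
    (a m : ℕ) (ha : a = 4 ∨ a = 5) (hm : 1 ≤ m) (han : a < n) (hmn : m < n)
    (hS8 : ∀ o ∈ orbs8, (∀ e ∈ o.coeffs, e.ell.Prime ∧ e.ell ≠ 2 ∧ ¬ e.ell ∣ 8 * ℓ) ∧
      (o.Eliminated bs04Allowed n ∨ (M.Excludes (8 * ℓ) o (famAB (ℓ ^ m) (2 ^ a) n (fun _ _ => True)) ∨ M.ExcludesStd (8 * ℓ) o n)))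
    (x y z : ℤ) (hy : ¬ 2 ∣ y) (hxy1 : x * y ≠ 1) (hxy2 : x * y ≠ -1) :
    ¬ IsPrimitiveSolution (ℓ ^ m) (2 ^ a) 1 n x y z := by
  intro hsol
  obtain ⟨hA, hB, hnAB, hfree⟩ := sideAB ℓ a m n hℓ hℓ2 hn (by omega) hnℓ han hmn
  obtain ⟨-, -, hL8, -⟩ := levelsC2aAB ℓ hℓ hℓ2 n hnℓ a m hm
  have hBeven : 2 ∣ ((2 ^ a : ℕ) : ℤ) := by
    push_cast
    rcases ha with rfl | rfl <;> norm_num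
  have hx := odd_x_of_even_B' hsol hBeven
  have hxy : ¬ 2 ∣ x * y := not_two_dvd_mul hx hy
  have hB45 : OrdTwoEq ((2 ^ a : ℕ) : ℤ) 4 ∨ OrdTwoEq ((2 ^ a : ℕ) : ℤ) 5 := by
    rcases ha with rfl | rfl
    · left
      have : ((2 ^ 4 : ℕ) : ℤ) = 2 ^ 4 * 1 := by norm_num
      rw [this]; exact ordTwoEq_twoPow_mul_odd 4 1 (by omega)
    · right
      have : ((2 ^ 5 : ℕ) : ℤ) = 2 ^ 5 * 1 := by norm_num
      rw [this]; exact ordTwoEq_twoPow_mul_odd 5 1 (by omega)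
  exact xbranchAB_iv45 _ _ hA hB M hP n hn h7 hnAB hfree (8 * ℓ) hL8 (fun _ _ => True) hD8 hS8 x y z trivial hB45
    hxy hxy1 hxy2 hsol

/-- **Class `a = 3`, `y` odd** (distribution `(1, 8 ℓ^m)`; level `32ℓ`). -/
theorem xrowC2a_a3_yodd (ℓ : ℕ) (hℓ : ℓ.Prime) (hℓ2 : ℓ ≠ 2) (M : NewformModel) (hP : M.BS04Package)
    (n : ℕ) (hn : n.Prime) (h7 : 7 ≤ n) (hnℓ : n ≠ ℓ) {orbs32 : List OrbitData}
    (hD32 : M.DataComplete (32 * ℓ) orbs32) (m : ℕ) (hm : 1 ≤ m) (hmn : m < n)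
    (hS32 : ∀ o ∈ orbs32, (∀ e ∈ o.coeffs, e.ell.Prime ∧ e.ell ≠ 2 ∧ ¬ e.ell ∣ 32 * ℓ) ∧
      (o.Eliminated bs04Allowed n ∨ (M.Excludes (32 * ℓ) o (famB (2 ^ 3 * ℓ ^ m) n (fun _ _ => True)) ∨ M.ExcludesStd (32 * ℓ) o n)))
    (x y z : ℤ) (hy : ¬ 2 ∣ y) (hxy1 : x * y ≠ 1) (hxy2 : x * y ≠ -1) :
    ¬ IsPrimitiveSolution 1 (2 ^ 3 * ℓ ^ m) 1 n x y z := by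
  intro hsol
  have hB : 0 < 2 ^ 3 * ℓ ^ m := by have := hℓ.pos; positivity
  have hnB := not_dvd_twoPow_primePow ℓ 3 m n hℓ hn (by omega) hnℓ
  have hfreeB := nthPowerFree_twoPow_primePow ℓ 3 m n hℓ hℓ2 (by omega) hmn
  obtain ⟨-, -, -, hL32, -⟩ := levelsC2a ℓ hℓ hℓ2 n hnℓ 3 m hm
  have hℓodd := prime_odd_int ℓ hℓ hℓ2
  have hBeven : 2 ∣ ((2 ^ 3 * ℓ ^ m : ℕ) : ℤ) := by push_cast; exact Dvd.dvd.mul_right ⟨4, by norm_num⟩ _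
  have hx := odd_x_of_even_B hsol hBeven
  have hxy : ¬ 2 ∣ x * y := not_two_dvd_mul hx hy
  have hB3 : OrdTwoEq ((2 ^ 3 * ℓ ^ m : ℕ) : ℤ) 3 := by
    push_cast; exact ordTwoEq_twoPow_mul_odd 3 _ (not_two_dvd_pow hℓodd m)
  exact xbranch_iv3 _ hB M hP n hn h7 hnB hfreeB (32 * ℓ) hL32 (fun _ _ => True) hD32 hS32 x y z trivial hB3 hxy
    hxy1 hxy2 hsol

/-- Distribution `(ℓ^m, 2^3)`, **class `a = 3`, `y` odd** (level `32ℓ`). -/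
theorem xrowC2aAB_a3_yodd (ℓ : ℕ) (hℓ : ℓ.Prime) (hℓ2 : ℓ ≠ 2) (M : NewformModel) (hP : M.BS04Package)
    (n : ℕ) (hn : n.Prime) (h7 : 7 ≤ n) (hnℓ : n ≠ ℓ) {orbs32 : List OrbitData}
    (hD32 : M.DataComplete (32 * ℓ) orbs32) (m : ℕ) (hm : 1 ≤ m) (hmn : m < n)
    (hS32 : ∀ o ∈ orbs32, (∀ e ∈ o.coeffs, e.ell.Prime ∧ e.ell ≠ 2 ∧ ¬ e.ell ∣ 32 * ℓ) ∧
      (o.Eliminated bs04Allowed n ∨ (M.Excludes (32 * ℓ) o (famAB (ℓ ^ m) (2 ^ 3) n (fun _ _ => True)) ∨ M.ExcludesStd (32 * ℓ) o n)))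
    (x y z : ℤ) (hy : ¬ 2 ∣ y) (hxy1 : x * y ≠ 1) (hxy2 : x * y ≠ -1) :
    ¬ IsPrimitiveSolution (ℓ ^ m) (2 ^ 3) 1 n x y z := by
  intro hsol
  obtain ⟨hA, hB, hnAB, hfree⟩ := sideAB ℓ 3 m n hℓ hℓ2 hn (by omega) hnℓ (by omega) hmn
  obtain ⟨-, -, -, hL32, -⟩ := levelsC2aAB ℓ hℓ hℓ2 n hnℓ 3 m hm
  have hBeven : 2 ∣ ((2 ^ 3 : ℕ) : ℤ) := by norm_num
  have hx := odd_x_of_even_B' hsol hBeven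
  have hxy : ¬ 2 ∣ x * y := not_two_dvd_mul hx hy
  have hB3 : OrdTwoEq ((2 ^ 3 : ℕ) : ℤ) 3 := by
    have : ((2 ^ 3 : ℕ) : ℤ) = 2 ^ 3 * 1 := by norm_num
    rw [this]; exact ordTwoEq_twoPow_mul_odd 3 1 (by omega)
  exact xbranchAB_iv3 _ _ hA hB M hP n hn h7 hnAB hfree (32 * ℓ) hL32 (fun _ _ => True) hD32 hS32 x y z trivial hB3
    hxy hxy1 hxy2 hsol

/-- **Class `a = 0`, `xy` odd** (`B = ℓ^m` odd; case (i), level `32ℓ`). -/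
theorem xrowC2a_a0_xyodd (ℓ : ℕ) (hℓ : ℓ.Prime) (hℓ2 : ℓ ≠ 2) (M : NewformModel) (hP : M.BS04Package)
    (n : ℕ) (hn : n.Prime) (h7 : 7 ≤ n) (hnℓ : n ≠ ℓ) {orbs32 : List OrbitData}
    (hD32 : M.DataComplete (32 * ℓ) orbs32) (m : ℕ) (hm : 1 ≤ m) (hmn : m < n)
    (hS32 : ∀ o ∈ orbs32, (∀ e ∈ o.coeffs, e.ell.Prime ∧ e.ell ≠ 2 ∧ ¬ e.ell ∣ 32 * ℓ) ∧
      (o.Eliminated bs04Allowed n ∨ (M.Excludes (32 * ℓ) o (famB (2 ^ 0 * ℓ ^ m) n (fun _ _ => True)) ∨ M.ExcludesStd (32 * ℓ) o n)))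
    (x y z : ℤ) (hxy : ¬ 2 ∣ x * y) (hxy1 : x * y ≠ 1) (hxy2 : x * y ≠ -1) :
    ¬ IsPrimitiveSolution 1 (2 ^ 0 * ℓ ^ m) 1 n x y z := by
  intro hsol
  have hB : 0 < 2 ^ 0 * ℓ ^ m := by have := hℓ.pos; positivity
  have hnB := not_dvd_twoPow_primePow ℓ 0 m n hℓ hn (by omega) hnℓ
  have hfreeB := nthPowerFree_twoPow_primePow ℓ 0 m n hℓ hℓ2 (by omega) hmn
  obtain ⟨-, -, -, -, -, -, -, hL32, hL32', -⟩ := levelsC2a ℓ hℓ hℓ2 n hnℓ 0 m hm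
  have hℓodd := prime_odd_int ℓ hℓ hℓ2
  have hBodd : ¬ 2 ∣ ((2 ^ 0 * ℓ ^ m : ℕ) : ℤ) := by
    push_cast; simpa using not_two_dvd_pow hℓodd m
  exact xbranch_i_odd _ hB hBodd M hP n hn h7 hnB hfreeB (32 * ℓ) hL32 hL32' (fun _ _ => True) hD32 hS32
    x y z trivial hxy hxy1 hxy2 hsol

/-- **Class `a = 0`, `xy` even** (`B = ℓ^m` odd; case (v₇) after the swap, level `2ℓ`). -/
theorem xrowC2a_a0_xyeven (ℓ : ℕ) (hℓ : ℓ.Prime) (hℓ2 : ℓ ≠ 2) (M : NewformModel) (hP : M.BS04Package)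
    (n : ℕ) (hn : n.Prime) (h7 : 7 ≤ n) (hnℓ : n ≠ ℓ) {orbs2 : List OrbitData}
    (hD2 : M.DataComplete (2 * ℓ) orbs2) (m : ℕ) (hm : 1 ≤ m) (hmn : m < n)
    (hS2 : ∀ o ∈ orbs2, (∀ e ∈ o.coeffs, e.ell.Prime ∧ e.ell ≠ 2 ∧ ¬ e.ell ∣ 2 * ℓ) ∧
      (o.Eliminated bs04Allowed n ∨ (M.Excludes (2 * ℓ) o (famB (2 ^ 0 * ℓ ^ m) n (fun _ _ => True)) ∨ M.ExcludesStd (2 * ℓ) o n)))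
    (x y z : ℤ) (hxy : 2 ∣ x * y) :
    ¬ IsPrimitiveSolution 1 (2 ^ 0 * ℓ ^ m) 1 n x y z := by
  intro hsol
  have hB : 0 < 2 ^ 0 * ℓ ^ m := by have := hℓ.pos; positivity
  have hnB := not_dvd_twoPow_primePow ℓ 0 m n hℓ hn (by omega) hnℓ
  have hfreeB := nthPowerFree_twoPow_primePow ℓ 0 m n hℓ hℓ2 (by omega) hmn
  obtain ⟨hL2, -, -, -, -, -, -, -, -, hL2'⟩ := levelsC2a ℓ hℓ hℓ2 n hnℓ 0 m hm
  exact xbranch_even_Bodd _ hB M hP n hn h7 hnB hfreeB (2 * ℓ) hL2 hL2' (fun _ _ => True) hD2 hS2 x y z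
    trivial hxy hsol

end Summit.Ventures.AbcSig
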